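import Mathlib
import Literature.Analysis.FluidPDE.SteadyNSLatticePersistence
import HarnessLib

/-!
# Stub `stub_truncationOnW` of the line `registered`
# (crux stmt-AnomalousDissipation-11414, `WindLine.WindyGalerkinSteadyZerothLaw`)

Registered stub 3 of the skeleton `Cruxes/WindyGalerkinSteadyZerothLaw/Lines/birth.lean`: on the state space
`W ⊂ ℓ²(ℤ³; ℂ³)` of `Literature.Analysis.FluidPDE.SteadyLattice.exists_space` (zero mean mode, transversal,
conjugate-symmetric square-summable families, a real normed space, characterised by the membership hypothesis `hW`),
the Fourier truncations `P_N x = 1_{freqBall N} · x` to the symmetric frequency balls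
`freqBall N = {k : |k|² ≤ N²}` are real continuous linear maps `W →L[ℝ] W` with the stated coordinates, idempotent,
of norm at most one, and converging strongly to the identity.

Proof (folklore; Constantin–Foias 1988, Ch. 8, (8.3); Robinson–Rodrigo–Sadowski 2016, §4.1): the truncation is first
built on `ℓ²` (`exists_truncL2`: the truncated family is dominated termwise, hence square summable and of smaller
norm; linearity is coordinatewise; `LinearMap.mkContinuous`), it maps `W` into `W` because the three defining
conditions are coordinatewise and `freqBall N` is symmetric (`trunc_mem`, `IsConjSymm.indicator`), and it converges
strongly because `T_N x = ∑_{k ∈ freqBall N} δ_k x(k)` is a partial sum of the unconditionally convergent expansion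
`x = ∑ₖ δ_k x(k)` (`lp.hasSum_single`) along the exhausting sequence `freqBall N → ⊤`
(`tendsto_freqBall_atTop`); the maps on `W` are the (co)restrictions, and `W ⊂ ℓ²` is isometric.

No definitions are introduced; the maps are delivered by existence statements, as in the tree.  The local
notations `ℂ³`, `ℓ2`, `kdot[·,·]` are the skeleton's (copied verbatim so that the registered header matches).
-/

noncomputable section

-- D-0017: single-problem summit ⇒ the duplicated namespace segment is by design.
set_option linter.dupNamespace false

open scoped InnerProductSpace Topology ComplexConjugate ENNReal
open MeasureTheory Filter UnitAddTorus
open Literature.Analysis.FunctionSpaces Literature.Analysis.FunctionSpaces.Torus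
open Literature.Analysis.FunctionSpaces.EuclideanSpace
open Literature.Analysis.FluidPDE Literature.Analysis.FluidPDE.Torus
open Literature.Analysis.FluidPDE.ScalarFourier
open Literature.Analysis.FluidPDE.SteadyLattice

namespace Summit.AnomalousDissipation.AnomalousDissipation.Theorems.WindLineWindyGalerkinSteadyZerothLaw

/-- Complex coefficient vectors (local notation). -/
local notation "ℂ³" => EuclideanSpace ℂ (Fin 3)
/-- Square-summable coefficient families `ℤ³ → ℂ³` (local notation). -/
local notation "ℓ2" => lp (fun _ : Fin 3 → ℤ => EuclideanSpace ℂ (Fin 3)) 2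
/-- `k · v = ∑ⱼ kⱼ vⱼ` (local notation, the tree's `kdot`). -/
local notation "kdot[" k "," v "]" => (∑ jj : Fin 3, (((k : Fin 3 → ℤ) jj : ℤ) : ℂ) * (v : EuclideanSpace ℂ (Fin 3)) jj)

/-! ## The truncation on `ℓ²(ℤ³; ℂ³)` -/

/-- Termwise, the truncated family is dominated by the original one. -/
theorem norm_truncCoord_le (N : ℕ) (x : (Fin 3 → ℤ) → ℂ³) (k : Fin 3 → ℤ) :
    ‖(if k ∈ freqBall N then x k else 0 : ℂ³)‖ ≤ ‖x k‖ := by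
  split_ifs
  · exact le_rfl
  · rw [norm_zero]; exact norm_nonneg _

/-- The truncated family of a square-summable family is square summable. -/
theorem memℓp_truncCoord (N : ℕ) (x : ℓ2) :
    Memℓp (fun k : Fin 3 → ℤ => if k ∈ freqBall N then (x : (Fin 3 → ℤ) → ℂ³) k else 0) 2 :=
  (lp.memℓp x).mono' fun k => norm_truncCoord_le N _ k

/-- **Fourier truncation on `ℓ²(ℤ³; ℂ³)`**: for every `N` there is a real continuous linear map `T_N` of `ℓ²` with
coordinates `(T_N x)(k) = 1_{freqBall N}(k) x(k)`, and `‖T_N x‖ ≤ ‖x‖`. -/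
theorem exists_truncL2 :
    ∃ T : ℕ → ℓ2 →L[ℝ] ℓ2,
      (∀ (N : ℕ) (x : ℓ2) (k : Fin 3 → ℤ), ((T N x : ℓ2) : (Fin 3 → ℤ) → ℂ³) k =
        if k ∈ freqBall N then (x : (Fin 3 → ℤ) → ℂ³) k else 0) ∧
      ∀ (N : ℕ) (x : ℓ2), ‖T N x‖ ≤ ‖x‖ := by
  have key : ∀ N : ℕ, ∃ T : ℓ2 →L[ℝ] ℓ2,
      (∀ (x : ℓ2) (k : Fin 3 → ℤ), ((T x : ℓ2) : (Fin 3 → ℤ) → ℂ³) k =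
        if k ∈ freqBall N then (x : (Fin 3 → ℤ) → ℂ³) k else 0) ∧ ∀ x : ℓ2, ‖T x‖ ≤ ‖x‖ := by
    intro N
    -- the raw linear map, packaged with its coordinate formula
    obtain ⟨L, hLc⟩ : ∃ L : ℓ2 →ₗ[ℝ] ℓ2, ∀ (x : ℓ2) (k : Fin 3 → ℤ), ((L x : ℓ2) : (Fin 3 → ℤ) → ℂ³) k =
        if k ∈ freqBall N then (x : (Fin 3 → ℤ) → ℂ³) k else 0 :=
      ⟨{ toFun := fun x =>
           ⟨fun k => if k ∈ freqBall N then (x : (Fin 3 → ℤ) → ℂ³) k else 0, memℓp_truncCoord N x⟩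
         map_add' := fun x y => by
           refine lp.ext (funext fun k => ?_)
           change (if k ∈ freqBall N then ((x + y : ℓ2) : (Fin 3 → ℤ) → ℂ³) k else 0) =
             (if k ∈ freqBall N then (x : (Fin 3 → ℤ) → ℂ³) k else 0) +
               (if k ∈ freqBall N then (y : (Fin 3 → ℤ) → ℂ³) k else 0)
           rw [lp.coeFn_add, Pi.add_apply]
           split_ifs
           · rfl
           · rw [add_zero]
         map_smul' := fun a x => by
           refine lp.ext (funext fun k => ?_)
           change (if k ∈ freqBall N then ((a • x : ℓ2) : (Fin 3 → ℤ) → ℂ³) k else 0) =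
             a • (if k ∈ freqBall N then (x : (Fin 3 → ℤ) → ℂ³) k else 0)
           rw [lp.coeFn_smul, Pi.smul_apply]
           split_ifs
           · rfl
           · rw [smul_zero] },
        fun x k => rfl⟩
    -- the norm bound, termwise
    have hLb : ∀ x : ℓ2, ‖L x‖ ≤ 1 * ‖x‖ := by
      intro x
      rw [one_mul]
      refine l2_norm_le_of_tsum_le _ (norm_nonneg x) ?_
      rw [ofReal_norm, l2_enorm_sq_eq_tsum]
      exact ENNReal.tsum_le_tsum fun k => by
        rw [hLc, ← ofReal_norm, ← ofReal_norm]
        gcongr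
        exact norm_truncCoord_le N _ k
    exact ⟨L.mkContinuous 1 hLb, hLc, fun x => (hLb x).trans_eq (one_mul _)⟩
  choose T hT hTn using key
  exact ⟨T, hT, hTn⟩

/-- **Strong convergence of the truncations on `ℓ²`**: any family of maps with the truncation coordinates converges
pointwise to the identity, since `T_N x = ∑_{k ∈ freqBall N} δ_k x(k)` is a partial sum of `x = ∑ₖ δ_k x(k)` along the
exhausting balls. -/
theorem tendsto_of_truncCoord (T : ℕ → ℓ2 →L[ℝ] ℓ2)
    (hT : ∀ (N : ℕ) (x : ℓ2) (k : Fin 3 → ℤ), ((T N x : ℓ2) : (Fin 3 → ℤ) → ℂ³) k =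
      if k ∈ freqBall N then (x : (Fin 3 → ℤ) → ℂ³) k else 0) (x : ℓ2) :
    Tendsto (fun N => T N x) atTop (𝓝 x) := by
  have h1 : HasSum (fun i : Fin 3 → ℤ => (lp.single 2 i ((x : (Fin 3 → ℤ) → ℂ³) i) : ℓ2)) x :=
    lp.hasSum_single ENNReal.ofNat_ne_top x
  have h2 : ∀ N : ℕ, (∑ i ∈ freqBall N, (lp.single 2 i ((x : (Fin 3 → ℤ) → ℂ³) i) : ℓ2)) = T N x := by
    intro N
    refine lp.ext (funext fun k => ?_)
    rw [lp.coeFn_sum, Finset.sum_apply, hT]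
    simp only [lp.coeFn_single]
    exact Finset.sum_pi_single k _ _
  exact (h1.comp tendsto_freqBall_atTop).congr h2

/-! ## The truncation on the state space `W` -/

/-- A family with the truncation coordinates of an element of `W` lies in `W`: the zero mode, transversality and
conjugate symmetry are coordinatewise conditions and `freqBall N` is symmetric. -/
theorem trunc_mem {W : Submodule ℝ ℓ2}
    (hW : ∀ x : ℓ2, x ∈ W ↔ ((x : (Fin 3 → ℤ) → ℂ³) 0 = 0 ∧
      (∀ kk : Fin 3 → ℤ, kdot[kk, (x : (Fin 3 → ℤ) → ℂ³) kk] = 0) ∧ IsConjSymm (x : (Fin 3 → ℤ) → ℂ³)))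
    (N : ℕ) (x : W) (y : ℓ2)
    (hy : ∀ k : Fin 3 → ℤ, (y : (Fin 3 → ℤ) → ℂ³) k =
      if k ∈ freqBall N then ((x : ℓ2) : (Fin 3 → ℤ) → ℂ³) k else 0) :
    y ∈ W := by
  refine (hW y).2 ⟨?_, fun kk => ?_, ?_⟩
  · rw [hy]
    by_cases hk : (0 : Fin 3 → ℤ) ∈ freqBall N
    · rw [if_pos hk]; exact W_zero hW x
    · rw [if_neg hk]
  · rw [hy]
    by_cases hk : kk ∈ freqBall N
    · rw [if_pos hk]; exact W_trans hW x kk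
    · rw [if_neg hk]; exact kdot_zero kk
  · have e : ((y : ℓ2) : (Fin 3 → ℤ) → ℂ³) =
        fun k => if k ∈ freqBall N then ((x : ℓ2) : (Fin 3 → ℤ) → ℂ³) k else 0 := funext hy
    rw [e]
    exact (W_conj hW x).indicator fun k hk => neg_mem_freqBall.2 hk

/-- **Registered stub 3 — Fourier truncation on `W`.**  On the closed real subspace `W ⊂ ℓ²(ℤ³; ℂ³)` of zero-mean,
transversal, conjugate-symmetric families (membership characterised by `hW`), the truncations to the symmetric balls
`freqBall N` are continuous linear maps `P N : W →L[ℝ] W` with coordinates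
`(P N x)(k) = if k ∈ freqBall N then x k else 0`, idempotent, of norm `≤ 1`, and `P N x → x` for every `x`
(Constantin–Foias 1988, Ch. 8, (8.3); folklore). -/
theorem stub_truncationOnW :
    ∀ (W : Submodule ℝ ℓ2),
      (∀ x : ℓ2, x ∈ W ↔ ((x : (Fin 3 → ℤ) → ℂ³) 0 = 0 ∧ (∀ kk : Fin 3 → ℤ, kdot[kk, (x : (Fin 3 → ℤ) → ℂ³) kk] = 0) ∧
        IsConjSymm (x : (Fin 3 → ℤ) → ℂ³))) →
      IsClosed (W : Set ℓ2) →
      ∃ P : ℕ → W →L[ℝ] W,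
        (∀ (N : ℕ) (x : W) (k : Fin 3 → ℤ),
          (((P N x : W) : ℓ2) : (Fin 3 → ℤ) → ℂ³) k = if k ∈ freqBall N then ((x : ℓ2) : (Fin 3 → ℤ) → ℂ³) k else 0) ∧
        (∀ N x, P N (P N x) = P N x) ∧ (∀ N x, ‖P N x‖ ≤ ‖x‖) ∧
        (∀ x, Tendsto (fun N => P N x) atTop (𝓝 x)) := by
  intro W hW _
  obtain ⟨T, hT, hTn⟩ := exists_truncL2
  have hmem : ∀ (N : ℕ) (x : W), T N (x : ℓ2) ∈ W := fun N x => trunc_mem hW N x (T N (x : ℓ2)) (hT N x)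
  refine ⟨fun N => ((T N).comp W.subtypeL).codRestrict W (hmem N), fun N x k => hT N x k, fun N x => ?_,
    fun N x => hTn N x, fun x => ?_⟩
  · -- idempotent: coordinatewise
    refine Subtype.ext (lp.ext (funext fun k => ?_))
    change ((T N (T N (x : ℓ2)) : ℓ2) : (Fin 3 → ℤ) → ℂ³) k = ((T N (x : ℓ2) : ℓ2) : (Fin 3 → ℤ) → ℂ³) k
    by_cases hk : k ∈ freqBall N <;> simp [hT, hk]
  · -- strong convergence: `W ⊂ ℓ²` is isometric
    have h := tendsto_of_truncCoord T hT (x : ℓ2)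
    rw [tendsto_iff_norm_sub_tendsto_zero] at h ⊢
    exact h

end Summit.AnomalousDissipation.AnomalousDissipation.Theorems.WindLineWindyGalerkinSteadyZerothLaw

end
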